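import Mathlib.LinearAlgebra.Matrix.PosDef
import Mathlib.Algebra.Order.Star.Real
import Mathlib.Tactic.FieldSimp
import Mathlib.Tactic.Linarith
import Mathlib.Tactic.Positivity
import Mathlib.Tactic.Ring
import HarnessLib

/-!
# Interval lemma R-I — the linear-algebra core of the k-interval ("all Γ, d = 2, 3") certificates
# (cell `pub-turb` / `turb-bounds`, file of record `HOME/CERT-RB.md` §R R-I; refereed PASS in `tribunal/t-lemmas.md` pass 2)

HONEST FRAMING: rigorous bounds for the stated PDE and boundary conditions; no claim about physical turbulence
beyond the bound. This file contains NO fluid mechanics: it is the finite-dimensional fact that lets a finite set of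
exact PSD certificates cover a CONTINUUM of wavenumbers.

Setting (rbsdp SPEC §3 / FORMULATION-SPEC §B–§C): for a fixed background profile and truncation, the projected
spectral-constraint block of the Rayleigh–Bénard background method is AFFINE in the wavenumber data pair
`(u, v) = (KINV2, K2)`, with `u` a lower bound for `1/k²` and `v` a lower bound for `k²`:
`M(u, v) = M₀ + u • A + v • B`, where the coefficient `A` of `u` (the `W_xx`-mass term times `(s-1)/Ra`) is positive
semidefinite. A block built with data `(u, v)` certifies the constraint for every wavenumber `k` with `u ≤ 1/k²` and
`v ≤ k²` (the data only multiply nonnegative terms).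

THE LEMMA (`posSemidef_pencil_on_interval`): let `ℓ(K) = α + β K` be affine with `ℓ(K) ≤ 1/K` on `[Ka, Kb]`
(`0 < Ka`). If the two ENDPOINT matrices `M(ℓ(Ka), Ka)` and `M(ℓ(Kb), Kb)` are positive semidefinite, then
`M(1/K, K)` is positive semidefinite for EVERY `K ∈ [Ka, Kb]`. Proof: `K ↦ M(ℓ(K), K)` is affine in `K`, hence a
convex combination of the endpoint matrices on the interval (PSD cone is convex), and
`M(1/K, K) = M(ℓ(K), K) + (1/K - ℓ(K)) • A` with a nonnegative coefficient and `A ⪰ 0`.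
Instances used by the certificates: 'flat' `ℓ ≡ 1/Kb`; 'tangent' `ℓ(K) = (2Kt - K)/Kt²` (tangent of `1/K` at `Kt`,
below `1/K` by convexity — `tangent_le_inv` below); 'bottom' is the degenerate data `(1/K₁, 0)`.
Only `A ⪰ 0` is needed here (monotonicity in `v` uses `B ⪰ 0` and is not part of this lemma).
-/

namespace Summit.NavierStokesRegularity.TurbBounds

open Matrix

variable {n : Type*}

/-- The pencil evaluated along an affine data path `K ↦ (α + β K, K)` is a convex combination of its two
endpoint values: for `t ∈ ℝ` and `K = (1 - t) Ka + t Kb`,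
`M(α + βK, K) = (1 - t) • M(α + β Ka, Ka) + t • M(α + β Kb, Kb)`. Pure module algebra. -/
theorem pencil_affine_path (M₀ A B : Matrix n n ℝ) (α β Ka Kb t : ℝ) :
    (M₀ + (α + β * ((1 - t) * Ka + t * Kb)) • A + ((1 - t) * Ka + t * Kb) • B)
      = (1 - t) • (M₀ + (α + β * Ka) • A + Ka • B) + t • (M₀ + (α + β * Kb) • A + Kb • B) := by
  ext i j
  simp only [Matrix.add_apply, Matrix.smul_apply, smul_eq_mul]
  ring

/-- The tangent line of `K ↦ 1/K` at `Kt > 0` lies below `1/K` for `K > 0` (convexity of `1/K`):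
`(2 Kt - K)/Kt² ≤ 1/K`. This is the inequality the 'tangent' intervals of the certificates rely on. -/
theorem tangent_le_inv {Kt K : ℝ} (hKt : 0 < Kt) (hK : 0 < K) :
    (2 * Kt - K) / Kt ^ 2 ≤ 1 / K := by
  rw [div_le_div_iff₀ (by positivity) hK]
  nlinarith [sq_nonneg (K - Kt)]

/-- **Interval lemma R-I (core).** If `A ⪰ 0`, `ℓ(K) = α + β K ≤ 1/K` on `[Ka, Kb]` with `0 < Ka ≤ Kb`, and the two
endpoint matrices `M(ℓ(Ka), Ka)`, `M(ℓ(Kb), Kb)` of the pencil are positive semidefinite, then `M(1/K, K)` is positive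
semidefinite for every `K ∈ [Ka, Kb]`. -/
theorem posSemidef_pencil_on_interval [Fintype n] (M₀ A B : Matrix n n ℝ) (hA : A.PosSemidef)
    {α β Ka Kb : ℝ} (hKa : 0 < Ka) (hab : Ka ≤ Kb)
    (hℓ : ∀ K, Ka ≤ K → K ≤ Kb → α + β * K ≤ 1 / K)
    (h1 : (M₀ + (α + β * Ka) • A + Ka • B).PosSemidef)
    (h2 : (M₀ + (α + β * Kb) • A + Kb • B).PosSemidef) :
    ∀ K, Ka ≤ K → K ≤ Kb → (M₀ + (1 / K) • A + K • B).PosSemidef := by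
  intro K hK1 hK2
  have hKpos : 0 < K := lt_of_lt_of_le hKa hK1
  -- the affine-path value at K is PSD (convex combination of the endpoints)
  have hpath : (M₀ + (α + β * K) • A + K • B).PosSemidef := by
    rcases eq_or_lt_of_le hab with heq | hlt
    · -- degenerate interval: K = Ka
      have hKeq : K = Ka := le_antisymm (heq ▸ hK2) hK1
      rw [hKeq]; exact h1
    · set t : ℝ := (K - Ka) / (Kb - Ka) with ht
      have hden : 0 < Kb - Ka := sub_pos.mpr hlt
      have ht0 : 0 ≤ t := div_nonneg (sub_nonneg.mpr hK1) hden.le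
      have ht1 : t ≤ 1 := by
        rw [ht, div_le_one hden]; linarith
      have hKt : K = (1 - t) * Ka + t * Kb := by
        rw [ht]; field_simp; ring
      have key := pencil_affine_path M₀ A B α β Ka Kb t
      rw [← hKt] at key
      rw [key]
      exact (h1.smul (sub_nonneg.mpr ht1)).add (h2.smul ht0)
  -- M(1/K, K) = M(ℓ(K), K) + (1/K - ℓ(K)) • A with a nonnegative coefficient
  have hdecomp : M₀ + (1 / K) • A + K • B = (M₀ + (α + β * K) • A + K • B) + (1 / K - (α + β * K)) • A := by
    ext i j
    simp only [Matrix.add_apply, Matrix.smul_apply, smul_eq_mul]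
    ring
  rw [hdecomp]
  exact hpath.add (hA.smul (sub_nonneg.mpr (hℓ K hK1 hK2)))

/-- The 'tangent' instance of R-I as used by the certificates (CERT-RB §R, kint.tangent_pairs with `Kt = Kb`):
PSD of the two matrices `M((2Kb - Ka)/Kb², Ka)` and `M(1/Kb, Kb)` implies PSD of `M(1/K, K)` on `[Ka, Kb]`. -/
theorem posSemidef_pencil_on_interval_tangent [Fintype n] (M₀ A B : Matrix n n ℝ) (hA : A.PosSemidef)
    {Ka Kb : ℝ} (hKa : 0 < Ka) (hab : Ka ≤ Kb)
    (h1 : (M₀ + ((2 * Kb - Ka) / Kb ^ 2) • A + Ka • B).PosSemidef)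
    (h2 : (M₀ + (1 / Kb) • A + Kb • B).PosSemidef) :
    ∀ K, Ka ≤ K → K ≤ Kb → (M₀ + (1 / K) • A + K • B).PosSemidef := by
  have hKb : 0 < Kb := lt_of_lt_of_le hKa hab
  -- ℓ(K) = 2/Kb - K/Kb² : α = 2/Kb, β = -1/Kb²
  have hℓ : ∀ K, Ka ≤ K → K ≤ Kb → 2 / Kb + (-1 / Kb ^ 2) * K ≤ 1 / K := by
    intro K hK1 _
    have hK : 0 < K := lt_of_lt_of_le hKa hK1
    have := tangent_le_inv hKb hK
    have e : 2 / Kb + (-1 / Kb ^ 2) * K = (2 * Kb - K) / Kb ^ 2 := by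
      field_simp; ring
    rw [e]; exact this
  have e1 : 2 / Kb + (-1 / Kb ^ 2) * Ka = (2 * Kb - Ka) / Kb ^ 2 := by field_simp; ring
  have e2 : 2 / Kb + (-1 / Kb ^ 2) * Kb = 1 / Kb := by field_simp; ring
  refine posSemidef_pencil_on_interval M₀ A B hA hKa hab hℓ ?_ ?_
  · rw [e1]; exact h1
  · rw [e2]; exact h2

/-- The 'flat' instance of R-I (kint.flat_pair): if additionally `B ⪰ 0`, the ONE matrix `M(1/Kb, Ka)` being PSD
implies `M(1/K, K)` PSD on `[Ka, Kb]` (monotone in both data: `u = 1/Kb ≤ 1/K`, `v = Ka ≤ K`). -/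
theorem posSemidef_pencil_on_interval_flat [Fintype n] (M₀ A B : Matrix n n ℝ) (hA : A.PosSemidef) (hB : B.PosSemidef)
    {Ka Kb : ℝ} (hKa : 0 < Ka) (hab : Ka ≤ Kb)
    (h : (M₀ + (1 / Kb) • A + Ka • B).PosSemidef) :
    ∀ K, Ka ≤ K → K ≤ Kb → (M₀ + (1 / K) • A + K • B).PosSemidef := by
  intro K hK1 hK2
  have hKb : 0 < Kb := lt_of_lt_of_le hKa hab
  have hK : 0 < K := lt_of_lt_of_le hKa hK1
  have hdecomp : M₀ + (1 / K) • A + K • B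
      = (M₀ + (1 / Kb) • A + Ka • B) + (1 / K - 1 / Kb) • A + (K - Ka) • B := by
    ext i j
    simp only [Matrix.add_apply, Matrix.smul_apply, smul_eq_mul]
    ring
  rw [hdecomp]
  have hu : 0 ≤ 1 / K - 1 / Kb := by
    rw [sub_nonneg]; exact one_div_le_one_div_of_le hK hK2
  exact (h.add (hA.smul hu)).add (hB.smul (sub_nonneg.mpr hK1))

end Summit.NavierStokesRegularity.TurbBounds
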